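import Summits.MatrixMultiplication.OmegaCensus.STPPSmallPatternT2Onset32
import Summits.MatrixMultiplication.OmegaCensus.STPPSmallPatternT2K4Order32
import Summits.MatrixMultiplication.OmegaCensus.STPPSmallPatternNone122K4Z32
import Summits.MatrixMultiplication.OmegaCensus.STPPSmallPatternNone122K4Z2pow5

/-!
# ω-census, small STPP pattern `(1,2,2)^k`: THE ORDER-32 HOST LIST OF `(1,2,2)⁴` IS EXACT (kernel, all abelian groups of order 32)

HONEST FRAMING (pub-omega census; verbatim): lottery ticket; floor = certified bounds/negative ranges.
Census STRUCTURE bookkeeping of the STPP track (seat pub-omega-stpp-3, gen 25; STRUCTURE row B5: the threshold column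
`T2(H) = max {k : (1,2,2)^k ⊆ H}` at the onset order `32` of `(1,2,2)⁴`), not progress on `ω`: small patterns in small groups bound
no exponent.

The all-abelian onset of `(1,2,2)⁴` is `32` (`stpp122pow4_onset_eq_32`, gen 24).  AT order `32` the engines (ENG2 `t2dfs`, stpp-3
`lister122`) reported the host list «the five non-cyclic, non-elementary types host; `ℤ/32` and `(ℤ/2)⁵` do not»; the five hosts
are kernel witnesses of ENG2 (`STPPSmallPatternT2K4Order32.lean`).  This file closes the two NON-hosts in the kernel — `ℤ/32`
(`STPPSmallPatternNone122K4Z32.lean`) and `(ℤ/2)⁵` (`STPPSmallPatternNone122K4Z2pow5.lean`), both by the MIN-FLAG normal form of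
gen 25 (`STPPSmallPatternKernelReflect122R/H/Z.lean`: pair-class rank pruning for `ℤ/32`, 8 870 s of kernel search instead of
≈ 26 700 s; the second stabiliser level for `(ℤ/2)⁵`, one `b₁`-branch instead of 28) — and states the host list INTRINSICALLY
over all finite abelian groups of order `32`:

* `stpp122pow4_order32_iff` — **a finite abelian group `G` of order `32` admits an STPP family of size pattern `(1,2,2)⁴` iff
  `G` is neither cyclic nor elementary abelian** (`¬ IsAddCyclic G ∧ ¬ ∀ x, 2 • x = 0`);
* `stpp122pow4_order32_hosts` — the seven types one by one (five host, two do not).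

The classification enters through the structure theorem `AddCommGroup.equiv_directSum_zmod_of_finite` and the domination /
capped-multiset machinery of `STPP222CubeFrom46.lean` (`order32_trichotomy`: an abelian group of order `32` is `ℤ/32`, is `(ℤ/2)⁵`,
or contains one of the five host types).

References: H. Cohn, R. Kleinberg, B. Szegedy, C. Umans, FOCS 2005 (arXiv:math/0511460), Def. 5.1.  Record: pub-omega HOME
`pub-omega-stpp-3-g25/`.
-/

open Literature.Computability.AlgebraicComplexity Finset

namespace Summit.MatrixMultiplication.OmegaCensus

/-! ## 1. Order 32: cyclic, elementary, or a host type inside -/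

/-- COMBINATORIAL CORE (kernel): a capped multiset of prime powers with product `32` is `{32}`, or `{2,2,2,2,2}`, or dominated by one of
the five host types. -/
theorem hostCore122K4Order32 : ∀ E ∈ List.range' 1 32, ∀ M ∈ subMS (capList E), M.prod = 32 →
    dom [32] M = true ∨ dom [2, 2, 2, 2, 2] M = true ∨
      ∃ s ∈ ([[2, 16], [4, 8], [2, 2, 8], [2, 4, 4], [2, 2, 2, 4]] : List (List ℕ)), dom s M = true := by
  decide +kernel

/-- **TRICHOTOMY AT ORDER 32**: a finite abelian group of order `32` is in bijection (additively) with `ℤ/32`, or with `(ℤ/2)⁵`, or one of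
the five host types embeds into it. [folklore] -/
theorem order32_trichotomy {G : Type*} [AddCommGroup G] [Finite G] (hG : Nat.card G = 32) :
    (∃ φ : SeedType [32] →+ G, Function.Bijective φ) ∨ (∃ φ : SeedType [2, 2, 2, 2, 2] →+ G, Function.Bijective φ) ∨
      ∃ s ∈ ([[2, 16], [4, 8], [2, 2, 8], [2, 4, 4], [2, 2, 2, 4]] : List (List ℕ)),
        ∃ φ : SeedType s →+ G, Function.Injective φ := by
  classical
  obtain ⟨ι, _, p, hp, e, ⟨g⟩⟩ := AddCommGroup.equiv_directSum_zmod_of_finite G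
  let f : G ≃+ (Π i, ZMod (p i ^ e i)) :=
    g.trans (DirectSum.linearEquivFunOnFintype ℕ ι (fun i => ZMod (p i ^ e i))).toAddEquiv
  have hE1 : 1 ≤ AddMonoid.exponent G := Nat.pos_of_ne_zero AddMonoid.exponent_ne_zero_of_finite
  have hEle : AddMonoid.exponent G ≤ 32 := le_trans (Nat.le_of_dvd Nat.card_pos AddGroup.exponent_dvd_nat_card) hG.le
  have hdvd : ∀ i, p i ^ e i ∣ AddMonoid.exponent G := fun i => by
    have hinj : Function.Injective (AddMonoidHom.single (fun j => ZMod (p j ^ e j)) i) :=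
      Pi.single_injective (M := fun j => ZMod (p j ^ e j)) i
    have h1 : addOrderOf (f.symm (AddMonoidHom.single (fun j => ZMod (p j ^ e j)) i 1)) = p i ^ e i := by
      rw [AddEquiv.addOrderOf_eq, addOrderOf_injective _ hinj, ZMod.addOrderOf_one]
    rw [← h1]
    exact AddMonoid.addOrder_dvd_exponent _
  have hcardeq : Nat.card G = ∏ i, p i ^ e i := by
    rw [Nat.card_congr f.toEquiv, Nat.card_pi]
    simp [Nat.card_zmod]
  have hq0 : ∀ i, p i ^ e i ≠ 0 := fun i => pow_ne_zero _ (hp i).ne_zero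
  haveI : ∀ i, NeZero (p i ^ e i) := fun i => ⟨hq0 i⟩
  set M : Multiset ℕ := (Finset.univ.filter fun i => 0 < e i).val.map fun i => p i ^ e i with hM
  have hprodeq : M.prod = ∏ i, p i ^ e i := by
    rw [hM, ← Finset.prod_eq_multiset_prod]
    exact Finset.prod_filter_of_ne fun i _ hi => Nat.pos_of_ne_zero fun h0 => hi (by rw [h0, pow_zero])
  have hmem : ∀ a ∈ M, a ∈ ppList ∧ a ∣ AddMonoid.exponent G := by
    intro a ha
    obtain ⟨i, hi, rfl⟩ := Multiset.mem_map.1 ha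
    have hi' : 0 < e i := (Finset.mem_filter.1 hi).2
    exact ⟨pow_mem_ppList (hp i) hi' (le_trans (Nat.le_of_dvd (by omega) (hdvd i)) (le_trans hEle (by norm_num))), hdvd i⟩
  have hEI : AddMonoid.exponent G ∈ List.range' 1 32 := List.mem_range'_1.2 ⟨hE1, by omega⟩
  have hEI45 : AddMonoid.exponent G ∈ List.range' 1 45 := List.mem_range'_1.2 ⟨hE1, by omega⟩
  have h32 : M.prod = 32 := by rw [hprodeq, ← hcardeq, hG]
  have hle : M ≤ capMS (capList (AddMonoid.exponent G)) :=
    le_capMS_of_prod_le45 hEI45 (fun a ha => (hmem a ha).1) (fun a ha => (hmem a ha).2) (by omega)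
  have hcardPi : Nat.card (Π i, ZMod (p i ^ e i)) = 32 := by rw [← Nat.card_congr f.toEquiv, hG]
  -- a dominated seed of product 32 maps BIJECTIVELY onto `G`
  have bij_of_dom : ∀ s : List ℕ, s.prod = 32 → dom s M = true → ∃ φ : SeedType s →+ G, Function.Bijective φ := by
    intro s hs hD
    obtain ⟨φ, hφ, -⟩ := exists_emb_of_dom (fun i => p i ^ e i) hq0 s _ hD
    have hcard : Nat.card (SeedType s) = Nat.card (Π i, ZMod (p i ^ e i)) := by rw [card_seedType, hs, hcardPi]
    have hbij : Function.Bijective φ := hφ.bijective_of_nat_card_le (le_of_eq hcard.symm)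
    exact ⟨f.symm.toAddMonoidHom.comp φ, f.symm.bijective.comp hbij⟩
  rcases hostCore122K4Order32 _ hEI M (mem_subMS_of_le _ _ hle) h32 with h1 | h2 | ⟨s, hs, hD⟩
  · exact Or.inl (bij_of_dom [32] (by norm_num) h1)
  · exact Or.inr (Or.inl (bij_of_dom [2, 2, 2, 2, 2] (by norm_num) h2))
  · obtain ⟨φ, hφ, -⟩ := exists_emb_of_dom (fun i => p i ^ e i) hq0 s _ hD
    exact Or.inr (Or.inr ⟨s, hs, f.symm.toAddMonoidHom.comp φ, f.symm.injective.comp hφ⟩)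

/-! ## 2. The five host types host; what they and `ℤ/32` are not -/

/-- Each of the five host types admits `(1,2,2)⁴` (ENG2's kernel witnesses, read on `SeedType`). [cite: CohnKleinbergSzegedyUmans2005, Def. 5.1] -/
theorem exists_122pow4_of_mem_hostSeeds :
    ∀ s ∈ ([[2, 16], [4, 8], [2, 2, 8], [2, 4, 4], [2, 2, 2, 4]] : List (List ℕ)),
      ∃ A B C : Fin 4 → Finset (SeedType s), IsSTPP A B C ∧ ∀ i, (A i).card = 1 ∧ (B i).card = 2 ∧ (C i).card = 2 := by
  intro s hs
  simp only [List.mem_cons, List.mem_nil_iff, or_false] at hs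
  rcases hs with rfl | rfl | rfl | rfl | rfl
  · exact exists_isSTPP_122pow4_zmod2_zmod16
  · exact exists_isSTPP_122pow4_zmod4_zmod8
  · exact exists_isSTPP_122pow4_zmod2_zmod2_zmod8
  · exact exists_isSTPP_122pow4_zmod2_zmod4_zmod4
  · exact exists_isSTPP_122pow4_zmod2_zmod2_zmod2_zmod4

/-- Each host type has an element not killed by `2` (it is not elementary abelian; kernel). [folklore] -/
theorem exists_two_nsmul_ne_zero_of_mem_hostSeeds :
    ∀ s ∈ ([[2, 16], [4, 8], [2, 2, 8], [2, 4, 4], [2, 2, 2, 4]] : List (List ℕ)), ∃ y : SeedType s, 2 • y ≠ 0 := by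
  intro s hs
  simp only [List.mem_cons, List.mem_nil_iff, or_false] at hs
  rcases hs with rfl | rfl | rfl | rfl | rfl
  · exact ⟨((0 : ZMod 2), (1 : ZMod 16)), by show 2 • ((0 : ZMod 2), (1 : ZMod 16)) ≠ 0; decide⟩
  · exact ⟨((0 : ZMod 4), (1 : ZMod 8)), by show 2 • ((0 : ZMod 4), (1 : ZMod 8)) ≠ 0; decide⟩
  · exact ⟨((0 : ZMod 2), (0 : ZMod 2), (1 : ZMod 8)), by show 2 • ((0 : ZMod 2), (0 : ZMod 2), (1 : ZMod 8)) ≠ 0; decide⟩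
  · exact ⟨((0 : ZMod 2), (0 : ZMod 4), (1 : ZMod 4)), by show 2 • ((0 : ZMod 2), (0 : ZMod 4), (1 : ZMod 4)) ≠ 0; decide⟩
  · exact ⟨((0 : ZMod 2), (0 : ZMod 2), (0 : ZMod 2), (1 : ZMod 4)),
      by show 2 • ((0 : ZMod 2), (0 : ZMod 2), (0 : ZMod 2), (1 : ZMod 4)) ≠ 0; decide⟩

/-- `(ℤ/2)⁵` is elementary abelian (kernel). [folklore] -/
theorem two_nsmul_eq_zero_seed22222 : ∀ y : SeedType [2, 2, 2, 2, 2], 2 • y = 0 := by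
  show ∀ y : ZMod 2 × ZMod 2 × ZMod 2 × ZMod 2 × ZMod 2, 2 • y = 0
  decide

/-- `ℤ/32` is not elementary abelian: `2 • 1 ≠ 0` (kernel). [folklore] -/
theorem exists_two_nsmul_ne_zero_seed32 : ∃ y : SeedType [32], 2 • y ≠ 0 :=
  ⟨(1 : ZMod 32), by show 2 • (1 : ZMod 32) ≠ 0; decide⟩

/-! ## 3. The host list over all finite abelian groups of order 32 -/

/-- **A cyclic group of order `32` admits no `(1,2,2)⁴`** (kernel cell `ℤ/32` transported along `addEquivOfAddCyclicCardEq`).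
[cite: CohnKleinbergSzegedyUmans2005, Def. 5.1] -/
theorem not_exists_isSTPP_122pow4_of_isAddCyclic_card_32 {G : Type*} [AddCommGroup G] [Finite G] (hG : Nat.card G = 32)
    [hc : IsAddCyclic G] :
    ¬ ∃ A B C : Fin 4 → Finset G, IsSTPP A B C ∧ ∀ i, (A i).card = 1 ∧ (B i).card = 2 ∧ (C i).card = 2 := by
  have hcard : Nat.card (ZMod 32) = Nat.card G := by rw [Nat.card_zmod, hG]
  let e : ZMod 32 ≃+ G := addEquivOfAddCyclicCardEq hcard
  exact not_exists_isSTPP_122_of_card_eq e.toAddMonoidHom e.injective hcard not_exists_isSTPP_122pow4_zmod32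

/-- **An elementary abelian group of order `32` admits no `(1,2,2)⁴`** (it is `(ℤ/2)⁵`: kernel cell transported).
[cite: CohnKleinbergSzegedyUmans2005, Def. 5.1] -/
theorem not_exists_isSTPP_122pow4_of_two_nsmul_eq_zero_card_32 {G : Type*} [AddCommGroup G] [Finite G] (hG : Nat.card G = 32)
    (h2 : ∀ x : G, 2 • x = 0) :
    ¬ ∃ A B C : Fin 4 → Finset G, IsSTPP A B C ∧ ∀ i, (A i).card = 1 ∧ (B i).card = 2 ∧ (C i).card = 2 := by
  rcases order32_trichotomy hG with ⟨φ, hφ⟩ | ⟨φ, hφ⟩ | ⟨s, hs, φ, hφ⟩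
  · -- `ℤ/32 ≅ G` would make `2 • φ 1 = φ 2 ≠ 0`
    exfalso
    obtain ⟨y, hy⟩ := exists_two_nsmul_ne_zero_seed32
    apply hy
    apply hφ.1
    rw [map_nsmul, map_zero]; exact h2 _
  · have hcard : Nat.card (SeedType [2, 2, 2, 2, 2]) = Nat.card G := by rw [card_seedType, hG]; norm_num
    exact not_exists_isSTPP_122_of_card_eq φ hφ.1 hcard not_exists_isSTPP_122pow4_z2_z2_z2_z2_z2
  · exfalso
    obtain ⟨y, hy⟩ := exists_two_nsmul_ne_zero_of_mem_hostSeeds s hs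
    apply hy
    apply hφ
    rw [map_nsmul, map_zero]; exact h2 _

/-- **A finite abelian group of order `32` that is neither cyclic nor elementary abelian admits `(1,2,2)⁴`** (one of the five host
types embeds). [cite: CohnKleinbergSzegedyUmans2005, Def. 5.1] -/
theorem exists_isSTPP_122pow4_of_card_32 {G : Type*} [AddCommGroup G] [Finite G] (hG : Nat.card G = 32) (hc : ¬ IsAddCyclic G)
    (h2 : ¬ ∀ x : G, 2 • x = 0) :
    ∃ A B C : Fin 4 → Finset G, IsSTPP A B C ∧ ∀ i, (A i).card = 1 ∧ (B i).card = 2 ∧ (C i).card = 2 := by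
  classical
  rcases order32_trichotomy hG with ⟨φ, hφ⟩ | ⟨φ, hφ⟩ | ⟨s, hs, φ, hφ⟩
  · exfalso
    haveI : IsAddCyclic (SeedType [32]) := show IsAddCyclic (ZMod 32) from inferInstance
    exact hc (isAddCyclic_of_surjective φ hφ.2)
  · exfalso
    refine h2 fun x => ?_
    obtain ⟨y, rfl⟩ := hφ.2 x
    rw [← map_nsmul, two_nsmul_eq_zero_seed22222, map_zero]
  · exact exists_isSTPP_122_of_injective φ hφ (exists_122pow4_of_mem_hostSeeds s hs)

/-- **THE ORDER-32 HOST LIST OF `(1,2,2)⁴`, INTRINSIC FORM (kernel, all finite abelian groups of order `32`): `G` admits an STPP family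
of size pattern `(1,2,2)⁴` (CKSU Def. 5.1) iff `G` is neither cyclic nor elementary abelian.**  No `ω` bound follows.
[cite: CohnKleinbergSzegedyUmans2005, Def. 5.1] -/
theorem stpp122pow4_order32_iff {G : Type*} [AddCommGroup G] [Finite G] (hG : Nat.card G = 32) :
    (∃ A B C : Fin 4 → Finset G, IsSTPP A B C ∧ ∀ i, (A i).card = 1 ∧ (B i).card = 2 ∧ (C i).card = 2) ↔
      (¬ IsAddCyclic G ∧ ¬ ∀ x : G, 2 • x = 0) := by
  constructor
  · intro h
    refine ⟨fun hc => ?_, fun h2 => ?_⟩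
    · exact not_exists_isSTPP_122pow4_of_isAddCyclic_card_32 hG h
    · exact not_exists_isSTPP_122pow4_of_two_nsmul_eq_zero_card_32 hG h2 h
  · rintro ⟨hc, h2⟩
    exact exists_isSTPP_122pow4_of_card_32 hG hc h2

/-- **THE ORDER-32 HOST LIST OF `(1,2,2)⁴`, TYPE BY TYPE (kernel): of the seven abelian groups of order `32`, exactly
`ℤ/2 × ℤ/16`, `ℤ/4 × ℤ/8`, `ℤ/2 × ℤ/2 × ℤ/8`, `ℤ/2 × ℤ/4 × ℤ/4`, `ℤ/2 × ℤ/2 × ℤ/2 × ℤ/4` host; `ℤ/32` and `(ℤ/2)⁵` do not.**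
[cite: CohnKleinbergSzegedyUmans2005, Def. 5.1] -/
theorem stpp122pow4_order32_hosts :
    ((∃ A B C : Fin 4 → Finset (ZMod 2 × ZMod 16), IsSTPP A B C ∧ ∀ i, (A i).card = 1 ∧ (B i).card = 2 ∧ (C i).card = 2) ∧
      (∃ A B C : Fin 4 → Finset (ZMod 4 × ZMod 8), IsSTPP A B C ∧ ∀ i, (A i).card = 1 ∧ (B i).card = 2 ∧ (C i).card = 2) ∧
      (∃ A B C : Fin 4 → Finset (ZMod 2 × ZMod 2 × ZMod 8), IsSTPP A B C ∧
        ∀ i, (A i).card = 1 ∧ (B i).card = 2 ∧ (C i).card = 2) ∧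
      (∃ A B C : Fin 4 → Finset (ZMod 2 × ZMod 4 × ZMod 4), IsSTPP A B C ∧
        ∀ i, (A i).card = 1 ∧ (B i).card = 2 ∧ (C i).card = 2) ∧
      (∃ A B C : Fin 4 → Finset (ZMod 2 × ZMod 2 × ZMod 2 × ZMod 4), IsSTPP A B C ∧
        ∀ i, (A i).card = 1 ∧ (B i).card = 2 ∧ (C i).card = 2)) ∧
    (¬ ∃ A B C : Fin 4 → Finset (ZMod 32), IsSTPP A B C ∧ ∀ i, (A i).card = 1 ∧ (B i).card = 2 ∧ (C i).card = 2) ∧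
    (¬ ∃ A B C : Fin 4 → Finset (ZMod 2 × ZMod 2 × ZMod 2 × ZMod 2 × ZMod 2), IsSTPP A B C ∧
      ∀ i, (A i).card = 1 ∧ (B i).card = 2 ∧ (C i).card = 2) :=
  ⟨exists_isSTPP_122pow4_order32, not_exists_isSTPP_122pow4_zmod32, not_exists_isSTPP_122pow4_z2_z2_z2_z2_z2⟩

/-- **`T2 = 3` EXACTLY at `ℤ/32` and at `(ℤ/2)⁵`** (kernel both ways). [cite: CohnKleinbergSzegedyUmans2005, Def. 5.1] -/
theorem stpp122_T2_eq_3_order32_nonhosts :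
    ((∃ A B C : Fin 3 → Finset (ZMod 32), IsSTPP A B C ∧ ∀ i, (A i).card = 1 ∧ (B i).card = 2 ∧ (C i).card = 2) ∧
      ¬ ∃ A B C : Fin 4 → Finset (ZMod 32), IsSTPP A B C ∧ ∀ i, (A i).card = 1 ∧ (B i).card = 2 ∧ (C i).card = 2) ∧
    ((∃ A B C : Fin 3 → Finset (ZMod 2 × ZMod 2 × ZMod 2 × ZMod 2 × ZMod 2), IsSTPP A B C ∧
        ∀ i, (A i).card = 1 ∧ (B i).card = 2 ∧ (C i).card = 2) ∧
      ¬ ∃ A B C : Fin 4 → Finset (ZMod 2 × ZMod 2 × ZMod 2 × ZMod 2 × ZMod 2), IsSTPP A B C ∧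
        ∀ i, (A i).card = 1 ∧ (B i).card = 2 ∧ (C i).card = 2) :=
  ⟨stpp122_T2_zmod32_eq_3, stpp122_T2_z2_z2_z2_z2_z2_eq_3⟩

end Summit.MatrixMultiplication.OmegaCensus
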